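import Summits.BirchSwinnertonDyer.BirchSwinnertonDyer.Theorems.UniversalToricDescentTwinTowerResidualCountIndex
import Summits.BirchSwinnertonDyer.BirchSwinnertonDyer.Theorems.UniversalToricDescentTwinTowerSigmaProduct
import Summits.BirchSwinnertonDyer.BirchSwinnertonDyer.Theorems.UniversalToricDescentDefectTransportTwinBaseFiniteOnly
import HarnessLib

/-!
# Route UniversalToricDescent — inputs of the ONE-SIDED defect transport (skeleton v4a's glue G≤ on ♭T≤ 23042):
# (M1) WITH INDEX on the route, and the Pontryagin count `#X_ac^Σ[p] = #(Sel_𝔭^Σ/p·Sel_𝔭^Σ)`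

Lead prover bsd-wall-utd-p1 g16 (`--supports` ♭T≤ stmt-BirchSwinnertonDyer-23042 `DefectTransportModThreePT` (one-sided restate of
26975, UTD rev 71); line `sigmacongruence`, temporary stub G≤ `stub_oneSidedGlue`).

* §1 `finite_and_natCard_selmerAc_pTorsion_baseChange_le_of_modPCongruent_of_surj` — the route instance of
  `finite_and_natCard_selmerAc_pTorsion_le_of_torsionIso_of_surj` (`…TwinTowerResidualCountIndex`): for `W, W′/ℚ` with
  `W′[p] ≅ W[p]`, `ρ̄_{W,p}` onto, `p` odd, `K` imaginary quadratic with `p` split, `κ` anticyclotomic, `𝔭 ∋ p` the strict place,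
  `Σ` finite prime to `p` containing the bad places, base data of the WILD curve only, and for the TWIN only the strict-place
  surjectivity (S′) in tuple form: `Sel_𝔭^Σ(K_∞, W′_K[p^∞])[p]` is FINITE and, granted `Sel′/p·Sel′` finite,
  **`#Sel^Σ(W′_K)[p] ≤ #Sel^Σ(W_K)[p] · #(Sel^Σ(W′_K)/p·Sel^Σ(W′_K))`**. Proof = g14's
  `natCard_selmerAc_pTorsion_baseChange_eq_of_modPCongruent_of_twinTower` with its last step re-sourced (no `hdiv′`, no (N′)).
* §2 `natCard_pTorsion_XAc_eq_natCard_quotient` — **`#X_ac^Σ[p] = #(Sel_𝔭^Σ/p·Sel_𝔭^Σ)`** (Pontryagin: the characters of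
  `Sel` killed by `p` are the characters of `Sel/p·Sel`; `#Hom(B, ℚ/ℤ) = #B`), the identity that lets the index of §1 CANCEL against
  the `p`-torsion of `X_ac^Σ(W′)` in `p^{λ(X)} · #X[p] = #Sel[p]` (Eisenstein cell's `pow_lambdaInvariant_mul_natCard_pTorsion_eq`).

HONEST STATUS: helper theorems, CONDITIONAL on the cited Poitou–Tate facts and on (S′) (stub TS1′). THEOREMS ONLY; no definition,
no named fact, no `sorry`. BSD is not advanced by this file.
References: [GreenbergVatsal2000] §2 Prop. (2.1), (2.8) (pp. 23–27); [GreenbergLNM1716] §1 p. 60, §4 Prop. 4.13; [Brink2007] Cor. 1.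
-/

set_option autoImplicit false
-- `…BirchSwinnertonDyer.BirchSwinnertonDyer.Theorems…` is the problem's mandated namespace (D-0017).
set_option linter.dupNamespace false

noncomputable section
open scoped Classical

namespace Summit.BirchSwinnertonDyer.BirchSwinnertonDyer.Theorems.UniversalToricDescentDefectTransport

open Function Field NumberField IsDedekindDomain WeierstrassCurve
open Literature.NumberTheory.GaloisRepresentations Literature.NumberTheory.EllipticCurves
  Literature.NumberTheory.EllipticCurves.GreenbergSelmer Literature.NumberTheory.GaloisCohomology
  Literature.NumberTheory.EllipticCurves.IwasawaAlgebra Literature.NumberTheory.EllipticCurves.Rank1Residual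
  Summit.BirchSwinnertonDyer.Rank1Residual Summit.BirchSwinnertonDyer.Rank1Residual.X11b
  Summit.BirchSwinnertonDyer.Rank1Residual.X11b.Coinv Summit.BirchSwinnertonDyer.Rank1Residual.X11b.AcSelmer
  Summit.BirchSwinnertonDyer.Rank1Residual.X11b.LocBridge Summit.BirchSwinnertonDyer.Rank1Residual.Iwasawa
  Summit.BirchSwinnertonDyer.BirchSwinnertonDyer.Theorems.UniversalToricDescentSigmaPassage
  Summit.BirchSwinnertonDyer.BirchSwinnertonDyer.Theorems.UniversalToricDescentSigmaLocalImage
  Summit.BirchSwinnertonDyer.BirchSwinnertonDyer.Theorems.UniversalToricDescentSigmaLocalStabilizer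
  Summit.BirchSwinnertonDyer.BirchSwinnertonDyer.Theorems.UniversalToricDescentSigmaCoinvariants
  Summit.BirchSwinnertonDyer.BirchSwinnertonDyer.Theorems.UniversalToricDescentAcDualMuZero
  Summit.BirchSwinnertonDyer.BirchSwinnertonDyer.Theorems.UniversalToricDescentTorsionMuTransportHeegner
  Summit.BirchSwinnertonDyer.BirchSwinnertonDyer.Theorems.UniversalToricDescentStrictPlaceTuple
  Summit.BirchSwinnertonDyer.BirchSwinnertonDyer.Theorems.UniversalToricDescentResidualSelmer
  Summit.BirchSwinnertonDyer.BirchSwinnertonDyer.Theorems.SchneiderFreeAdditiveX3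
  Summit.BirchSwinnertonDyer.BirchSwinnertonDyer.Theorems.SchneiderFreeControlAtoms
  Summit.BirchSwinnertonDyer.BirchSwinnertonDyer.Theorems.PotentiallySupersingularLocalTorsion

/-! ### §1 (M1) WITH INDEX on the route -/

/-- **`Sel_𝔭^Σ(K_∞, W′_K[p^∞])[p]` is finite and `#Sel^Σ(W′_K)[p] ≤ #Sel^Σ(W_K)[p] · #(Sel^Σ(W′_K)/p·Sel^Σ(W′_K))`** for
`W, W′/ℚ` with `W′[p] ≅ W[p]`, `ρ̄_{W,p}` onto, `p` odd, `K` imaginary quadratic with `p` split, `κ` anticyclotomic with topological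
generator `γ`, `𝔭 ∋ p` the strict place, `Σ` finite prime to `p` containing the bad places; GIVEN Poitou–Tate ×2 and base
finiteness at both `v ∣ p` for the WILD curve `W` only, `Sel_𝔭^Σ(K_∞, W_K[p^∞])[p]` finite, local tower torsion finiteness at `𝔭`
for both, and for the TWIN the strict-place tuple surjectivity (S′) `hsurj'` ONLY (no divisibility, no (N′)). Proof VERBATIM g14's
`natCard_selmerAc_pTorsion_baseChange_eq_of_modPCongruent_of_twinTower` up to the last step. [cite: GreenbergVatsal2000, §2 Prop. (2.1), (2.8)]
[cite: Brink2007, Cor. 1] [cite: MilneADT2006, Ch. I, Thm. 4.10] -/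
theorem finite_and_natCard_selmerAc_pTorsion_baseChange_le_of_modPCongruent_of_surj (W W' : WeierstrassCurve ℚ) [W.IsElliptic]
    [W.IsGloballyMinimal] [W'.IsElliptic] [W'.IsGloballyMinimal] (p : ℕ) [Fact p.Prime] (hp2 : p ≠ 2)
    {K : Type} [Field K] [NumberField K] (hK : IsImaginaryQuadratic K) (hsplit : SplitsIn K p)
    (hPT : poitouTate_selmerStructure_duality K) (hPT2 : poitouTate_sha_tateDual K)
    (κ : ZpExtension K p) (hκ : κ.IsAnticyclotomic) {γ : absoluteGaloisGroup K} (hγ : κ.IsTopGenerator γ)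
    {𝔭 : HeightOneSpectrum (𝓞 K)} (h𝔭 : ((p : ℕ) : 𝓞 K) ∈ 𝔭.asIdeal)
    (hsurj : W.HasSurjectiveModNGaloisRep (p : ℤ)) (hcong : O6.ModPCongruent W' W p)
    {S : Set (HeightOneSpectrum (𝓞 K))} (hS : S.Finite)
    (hSW : ∀ v : HeightOneSpectrum (𝓞 K), v ∉ S → ((p : ℕ) : 𝓞 K) ∉ v.asIdeal →
      (W.baseChange K).HasGoodReductionAt v)
    (hSW' : ∀ v : HeightOneSpectrum (𝓞 K), v ∉ S → ((p : ℕ) : 𝓞 K) ∉ v.asIdeal →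
      (W'.baseChange K).HasGoodReductionAt v)
    (hfin : ∀ v : HeightOneSpectrum (𝓞 K), ((p : ℕ) : 𝓞 K) ∈ v.asIdeal →
      Finite (selmerAcBase (W.baseChange K) p v ∅))
    (hsurj' : ∀ (v₀ : HeightOneSpectrum (𝓞 K)), ((p : ℕ) : 𝓞 K) ∉ v₀.asIdeal → v₀ ∉ S → ∀ (c : ℕ),
      (∀ z : ℤ_[p], ∃ d : decomp (K := K) 𝔭, (κ (d : absoluteGaloisGroup K)).toAdd = (p : ℤ_[p]) ^ c * z) →
      (∀ d : decomp (K := K) 𝔭, (p : ℤ_[p]) ^ c ∣ (κ (d : absoluteGaloisGroup K)).toAdd) →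
      ∀ g : Fin (p ^ c) → subgroupH1 (kerD κ 𝔭) ((W'.baseChange K).geomPrimaryTorsion p),
        ∃ s ∈ selmerAc (W'.baseChange K) p κ v₀ S, ∀ i : Fin (p ^ c),
          resKerD κ ((W'.baseChange K).geomPrimaryTorsion p) 𝔭
            ((W'.baseChange K).conjH1 p κ.kerSubgroup (γ ^ (i : ℕ)) s) = g i)
    (hfinS : Set.Finite {s : selmerAc (W.baseChange K) p κ 𝔭 S | p • s = 0})
    (hδ : LocalTowerTorsionFiniteAt (W.baseChange K) p κ 𝔭)
    (hδ' : LocalTowerTorsionFiniteAt (W'.baseChange K) p κ 𝔭) :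
    Set.Finite {s : selmerAc (W'.baseChange K) p κ 𝔭 S | p • s = 0} ∧
      (Finite (↥(selmerAc (W'.baseChange K) p κ 𝔭 S) ⧸
          (nsmulAddMonoidHom (α := ↥(selmerAc (W'.baseChange K) p κ 𝔭 S)) p).range) →
        Nat.card {s : selmerAc (W'.baseChange K) p κ 𝔭 S // p • s = 0} ≤
          Nat.card {s : selmerAc (W.baseChange K) p κ 𝔭 S // p • s = 0} *
            Nat.card (↥(selmerAc (W'.baseChange K) p κ 𝔭 S) ⧸
              (nsmulAddMonoidHom (α := ↥(selmerAc (W'.baseChange K) p κ 𝔭 S)) p).range)) := by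
  haveI : IsTotallyComplex K := hK.2
  haveI hEK : (W.baseChange K).IsElliptic := by rw [WeierstrassCurve.baseChange]; infer_instance
  haveI hEK' : (W'.baseChange K).IsElliptic := by rw [WeierstrassCurve.baseChange]; infer_instance
  -- the conjugate prime `𝔮` (degree one) and the killing exponents there
  obtain ⟨σ, 𝔮, -, hne, h𝔮, -⟩ :=
    LocalIndexTransport.exists_conj_prime_of_splitsIn K p hK.1 hsplit h𝔭
  obtain ⟨he𝔮, hf𝔮⟩ := degreeOne_of_splitsIn hK.1 hsplit h𝔮
  obtain ⟨m₁, hm₁⟩ := exists_pow_nsmul_fixedPoints_decomp_eq_zero W p 𝔮 h𝔮 he𝔮 hf𝔮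
  -- `H²(K, W_K[p^∞]) = 0` (wild curve)
  have htor := exists_pow_nsmul_local_eq_zero W p hK.1 hsplit
  haveI := hfin 𝔭 h𝔭
  have h2 := subsingleton_galoisCohomology_two_primary_anyTorsion (W.baseChange K) p 𝔭 ∅ hPT2
    (fieldCdLE_two_of_isTotallyComplex fieldCdLE_two_of_numberField_holds K p) htor
  -- `𝔭` is finitely decomposed (Brink) with exact index `p^c`
  have hv : ¬ (decomp 𝔭 ≤ κ.kerSubgroup) :=
    ZpExtension.decomp_not_le_kerSubgroup_above_of_isAnticyclotomic_holds K p hK hp2 κ hκ 𝔭 h𝔭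
  obtain ⟨c, -, hc, hle⟩ := exists_pow_and_forall_dvd_of_not_le κ 𝔭 hv
  -- a fake strict place `v₀ ∤ p` outside `Σ`
  haveI : Infinite (HeightOneSpectrum (𝓞 K)) := Literature.NumberTheory.Automorphic.infinite_heightOneSpectrum K
  have hp0 : p ≠ 0 := (Fact.out : p.Prime).ne_zero
  obtain ⟨v₀, hv₀⟩ := ((hS.union (H2Support.finite_setOf_natCast_mem (K := K) p hp0)).infinite_compl).nonempty
  have hv₀S : v₀ ∉ S := fun h ↦ hv₀ (Or.inl h)
  have hv₀p : ((p : ℕ) : 𝓞 K) ∉ v₀.asIdeal := fun h ↦ hv₀ (Or.inr h)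
  -- `W(K_∞)[p] = 0`, the torsion isomorphism
  have hG : ∀ m : (W.baseChange K).geomPrimaryTorsion p, (∀ σ ∈ κ.kerSubgroup, σ • m = m) → p • m = 0 → m = 0 := by
    intro m hm _
    have hmem : m ∈ FixedPoints.addSubgroup κ.kerSubgroup (geomPrimaryTorsion (W.baseChange K) p) := fun g ↦ hm g g.2
    rw [UniversalToricDescentTowerTorsion.fixedPoints_kerSubgroup_geomPrimaryTorsion_baseChange_eq_bot_of_surjective W p
      hsurj K hK κ] at hmem
    exact (AddSubgroup.mem_bot).mp hmem
  obtain ⟨e, he⟩ := UniversalToricDescentResidualSelmerTransfer.exists_torsionIso_baseChange_of_modPCongruent (K := K) W W' hcong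
  have hes : ∀ (σ : absoluteGaloisGroup K) (P : (W.baseChange K).geomTorsion (p : ℤ)),
      e.symm (σ • P) = σ • e.symm P := fun σ P ↦ by
    apply e.injective; rw [e.apply_symm_apply, he, e.apply_symm_apply]
  -- divisibility: `Sel = p·Sel` for both (for the twin from the finiteness the count provides)
  have hEP : ∀ v : HeightOneSpectrum (𝓞 K), localEulerPoincareCharacteristic (v.adicCompletion K) :=
    fun v ↦ GaloisImage.EP.localEulerPoincareCharacteristic_adicCompletion K v
  have hdiv : ∀ s ∈ selmerAc (W.baseChange K) p κ 𝔭 S, ∃ s' ∈ selmerAc (W.baseChange K) p κ 𝔭 S, p • s' = s :=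
    selmerAc_divisible_of_finite_pTorsion_anyTorsion (W.baseChange K) p κ hPT hEP h𝔭 h𝔮 hne hm₁ (hfin 𝔮 h𝔮) h2 γ
      (hγ := ⟨hγ⟩) hS hfinS
  -- local tower torsion finiteness in the `kerD` shape
  have hδ₁ : (FixedPoints.addSubgroup (kerD κ 𝔭) ((W.baseChange K).geomPrimaryTorsion p) :
      Set ((W.baseChange K).geomPrimaryTorsion p)).Finite := by
    rw [fixedPoints_kerD_eq]; exact hδ
  have hδ₂ : (FixedPoints.addSubgroup (kerD κ 𝔭) ((W'.baseChange K).geomPrimaryTorsion p) :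
      Set ((W'.baseChange K).geomPrimaryTorsion p)).Finite := by
    rw [fixedPoints_kerD_eq]; exact hδ'
  -- the (L)-free comparison along `e⁻¹ : W_K[p] ≅ W′_K[p]`
  exact finite_and_natCard_selmerAc_pTorsion_le_of_torsionIso_of_surj κ (W.baseChange K) (W'.baseChange K) hPT hEP h𝔭 h𝔮
    hne hm₁ (hfin 𝔮 h𝔮) h2 hγ hSW hSW' hv₀p hv₀S hc hle (hsurj' v₀ hv₀p hv₀S c hc hle) e.symm hes hG hdiv hfinS hδ₁ hδ₂


/-! ### §2 Pontryagin: `#X_ac^Σ[p] = #(Sel_𝔭^Σ / p·Sel_𝔭^Σ)` -/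

section Pontryagin

variable {A : Type*} [AddCommGroup A] (p : ℕ)

/-- **The characters of `A` killed by `n` are the characters of `A/nA`** (`#`-form): for any abelian group `A`,
`#{χ : A → ℚ/ℤ | n·χ = 0} = #(A/nA)` — `χ ↦ χ̄` is a bijection onto `Hom(A/nA, ℚ/ℤ)`, and `#Hom(B, ℚ/ℤ) = #B`
(`PontryaginCard.natCard_characterModule`). [folklore] -/
theorem natCard_nsmul_torsion_characterModule_eq_natCard_quotient (n : ℕ) :
    Nat.card {χ : A →+ AddCircle (1 : ℚ) // n • χ = 0} =
      Nat.card (A ⧸ (nsmulAddMonoidHom (α := A) n).range) := by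
  set R : AddSubgroup A := (nsmulAddMonoidHom (α := A) n).range with hR
  have hkill : ∀ χ : {χ : A →+ AddCircle (1 : ℚ) // n • χ = 0}, ∀ a ∈ R, χ.1 a = 0 := by
    rintro χ a ⟨b, rfl⟩
    rw [nsmulAddMonoidHom_apply, map_nsmul, ← AddMonoidHom.smul_apply, χ.2, AddMonoidHom.zero_apply]
  let e : {χ : A →+ AddCircle (1 : ℚ) // n • χ = 0} ≃ CharacterModule (A ⧸ R) :=
    { toFun := fun χ ↦ QuotientAddGroup.lift R χ.1 (hkill χ)
      invFun := fun ψ ↦ ⟨ψ.comp (QuotientAddGroup.mk' R), by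
        ext a
        have hmem : n • a ∈ R := AddMonoidHom.mem_range.mpr ⟨a, nsmulAddMonoidHom_apply n a⟩
        rw [AddMonoidHom.smul_apply, AddMonoidHom.comp_apply, QuotientAddGroup.mk'_apply, ← map_nsmul,
          ← QuotientAddGroup.mk_nsmul, (QuotientAddGroup.eq_zero_iff _).mpr hmem, map_zero, AddMonoidHom.zero_apply]⟩
      left_inv := fun χ ↦ Subtype.ext (AddMonoidHom.ext fun a ↦ rfl)
      right_inv := fun ψ ↦ AddMonoidHom.ext fun x ↦ by
        induction x using QuotientAddGroup.induction_on with
        | H a => rfl }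
  rw [Nat.card_congr e, PontryaginCard.natCard_characterModule]

end Pontryagin

/-- **`#X_ac^Σ(E[p^∞])[p] = #(Sel_𝔭^Σ(K_∞, E[p^∞]) / p·Sel_𝔭^Σ)`** — `X_ac^Σ` IS the character group of `Sel_𝔭^Σ`.
[cite: GreenbergLNM1716, §1 p. 60] -/
theorem natCard_pTorsion_XAc_eq_natCard_quotient {K : Type} [Field K] [NumberField K] (W : WeierstrassCurve K)
    (p : ℕ) [Fact p.Prime] (κ : ZpExtension K p) (𝔭 : HeightOneSpectrum (𝓞 K)) (S : Set (HeightOneSpectrum (𝓞 K)))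
    (γ : absoluteGaloisGroup K) [Fact (κ.IsTopGenerator γ)] :
    Nat.card {x : XAc W p κ 𝔭 S γ // p • x = 0} =
      Nat.card (↥(selmerAc W p κ 𝔭 S) ⧸ (nsmulAddMonoidHom (α := ↥(selmerAc W p κ 𝔭 S)) p).range) :=
  natCard_nsmul_torsion_characterModule_eq_natCard_quotient (A := ↥(selmerAc W p κ 𝔭 S)) p

end Summit.BirchSwinnertonDyer.BirchSwinnertonDyer.Theorems.UniversalToricDescentDefectTransport

end
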